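import Summits.AtomisticToContinuum.BoseEinsteinCondensation.Theorems.BECInfDivCoherenceGridInfDivCoherenceCoherencePosNonintegrable
import HarnessLib

/-!
# Crux `GridInfDivCoherence` (stmt-AtomisticToContinuum-9114), line `registered`: near-minimiser coherence positivity
# from ground-state coherence positivity (the fixed-`N` compactness reduction of the conjunct (P))

Lead c4 reshaped the crux's open content into statements about the `L²` ground states of the fixed-`N` torus
Hamiltonian. This file proves the soft half of that reduction for the POSITIVITY conjunct (P): if, at a box where
`E₀ < ⊤`, every unit vector of the maximal-form ground-state class has strictly positive translation amplitude
`re⟪τ_{i,u} f, f⟫` at every single-particle torus shift, then some `δ > 0` makes every `δ`-near-minimiser `Ψ` have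
strictly positive cell coherence `re ∫_{cell^N} conj Ψ(…, xᵢ + r, …) Ψ(X) dX` for all `i`, `r`
(`CoherencePosOfGroundStates.nearMin_pos_of_groundStates`); dilute and eventually in `N` this gives the registered stub
`stub_coherencePos_of_groundStates` (Ruelle finiteness supplies `E₀ < ⊤`). Proof: by particles (finitely many) and
contradiction — violating `1/(k+1)`-near-minimisers have a subsequence whose free-embedded classes converge in `L²` to a
unit ground state (`CoherencePosHC.exists_groundState_limit`, Rellich), the shifts converge on the compact torus, and the
amplitude is jointly continuous (`|re⟪Ua,a⟫ − re⟪Ub,b⟫| ≤ ‖a−b‖(‖a‖+‖b‖)` and strong continuity of translation), so the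
limit amplitude would be `≤ 0`. References: Reed–Simon IV Thm XIII.64 (compactness), XIII.44.
-/

noncomputable section

namespace Summit.AtomisticToContinuum.BoseEinsteinCondensation.Theorems

open MeasureTheory Filter Literature.MathematicalPhysics.QuantumManyBody Literature.MathematicalPhysics.QuantumManyBody.BoseGas
  Literature.Analysis.FunctionSpaces
  Summit.AtomisticToContinuum.BoseEinsteinCondensation.Cruxes.StaticResponseBound.UvThomsonForceWave
open scoped ENNReal NNReal ComplexConjugate InnerProductSpace Topology

-- Haar probability measure on `ℝ/ℤ`, as in `PeriodicFormDomain.lean` and the sibling landed files.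
attribute [local instance] formDomain_measureSpace formDomain_isProbabilityMeasure
  formDomain_isProbabilityMeasure_pi comparison_isAddHaarMeasure comparison_isAddRightInvariant

namespace CoherencePosOfGroundStates

variable {N : ℕ} {L : ℝ} {v : ℝ → ℝ≥0∞}

/-- Local notation for the Hilbert space `L²((ℝ/ℤ)^{3N})`. -/
local notation "L2T " N':max => Lp ℂ 2 (volume : Measure (UnitAddTorus (Fin N' × Fin 3)))

/-- Local notation: the translation `(τ_s g)(t) = g(t + s)` on `L²((ℝ/ℤ)^{3N})` (a linear isometry). -/
local notation "τ[" s "]" =>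
  Lp.compMeasurePreservingₗᵢ ℂ (fun t => t + s) (measurePreserving_add_right volume s)

set_option quotPrecheck false in
/-- Local notation: the FREE embedding `ι₀Ψ ∈ L²((ℝ/ℤ)^{3N})` of a periodic trial state (auxiliary profile `0`). -/
local notation "ι₀[" hL "," Ψ "]" =>
  formEmbed hL measurable_zeroProfile (lintegral_periodicInteraction_zero_ne_top _ _)
    ⟨graphEmbed hL measurable_zeroProfile (lintegral_periodicInteraction_zero_ne_top _ _)
      ⟨PeriodicTrialState.ψ Ψ, PeriodicTrialState.mem_periodicCore Ψ⟩, graphEmbed_mem_formDomain _ _ _ _⟩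

/-- **Joint continuity of the translation amplitude**: if `a_n → f` in `L²` and `s_n → s₀` on the torus, then
`re⟪τ_{s_n} a_n, a_n⟫ → re⟪τ_{s₀} f, f⟫` (stability `|re⟪Ua,a⟫ − re⟪Ub,b⟫| ≤ ‖a−b‖(‖a‖+‖b‖)` at the common shift, strong
continuity of translation at the common vector). [folklore] -/
theorem tendsto_re_inner_translate {a : ℕ → L2T N} {f : L2T N} {s : ℕ → UnitAddTorus (Fin N × Fin 3)}
    {s₀ : UnitAddTorus (Fin N × Fin 3)} (ha : Tendsto a atTop (𝓝 f)) (hs : Tendsto s atTop (𝓝 s₀)) :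
    Tendsto (fun n => (⟪(τ[s n] (a n) : L2T N), a n⟫_ℂ).re) atTop (𝓝 (⟪(τ[s₀] f : L2T N), f⟫_ℂ).re) := by
  -- the amplitude of `f` is continuous in the shift
  have h1 : Tendsto (fun n => (⟪(τ[s n] f : L2T N), f⟫_ℂ).re) atTop (𝓝 (⟪(τ[s₀] f : L2T N), f⟫_ℂ).re) :=
    ((Complex.continuous_re.comp ((CoherencePosL2.continuous_translate f).inner continuous_const)).tendsto s₀).comp hs
  -- the difference at a common shift is controlled by `‖a n - f‖ (‖a n‖ + ‖f‖) → 0`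
  have hnorm : Tendsto (fun n => ‖a n - f‖) atTop (𝓝 0) := tendsto_iff_norm_sub_tendsto_zero.1 ha
  have hbd : Tendsto (fun n => ‖a n - f‖ * (‖a n‖ + ‖f‖)) atTop (𝓝 0) := by
    have h := hnorm.mul ((continuous_norm.tendsto f).comp ha |>.add tendsto_const_nhds (b := ‖f‖))
    rwa [zero_mul] at h
  have h2 : Tendsto (fun n => (⟪(τ[s n] (a n) : L2T N), a n⟫_ℂ).re - (⟪(τ[s n] f : L2T N), f⟫_ℂ).re) atTop (𝓝 0) :=
    squeeze_zero_norm (fun n => by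
      rw [Real.norm_eq_abs]
      exact CoherencePosL2.abs_re_inner_map_sub_le _ (a n) f) hbd
  have h3 := h2.add h1
  simp only [sub_add_cancel, zero_add] at h3
  exact h3

/-- The single-particle torus shift `u ↦ (p ↦ single i u p.1 p.2)` is continuous. [folklore] -/
theorem continuous_singleShift (i : Fin N) :
    Continuous fun u : UnitAddTorus (Fin 3) =>
      (fun p : Fin N × Fin 3 => (Pi.single i u : Fin N → UnitAddTorus (Fin 3)) p.1 p.2) := by
  refine continuous_pi fun p => ?_
  rcases eq_or_ne p.1 i with h | h
  · simp only [h, Pi.single_eq_same]; exact continuous_apply p.2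
  · simp only [Pi.single_eq_of_ne h, Pi.zero_apply]; exact continuous_const

/-- **One particle.** At a box with `E₀ < ⊤` where every unit maximal-form ground state has positive translation
amplitude at every single-particle shift of particle `i`, some `δ > 0` makes every `δ`-near-minimiser have positive cell
coherence in particle `i` at every `r` (contradiction + `exists_groundState_limit` + compactness of the torus of shifts +
joint continuity). [cite: ReedSimonIV1978, Thm XIII.64] -/
theorem nearMin_pos_particle (hv : IsRepulsiveFiniteRange v) (hL : 0 < L)
    (hE : periodicGroundStateEnergy v N L ≠ ⊤) (i : Fin N)
    (hpos : ∀ f : L2T N, f ∈ maxFormGroundStates v N L → ‖f‖ = 1 → ∀ u : UnitAddTorus (Fin 3),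
      0 < (⟪(τ[fun p : Fin N × Fin 3 => (Pi.single i u : Fin N → UnitAddTorus (Fin 3)) p.1 p.2] f : L2T N), f⟫_ℂ).re) :
    ∃ δ : ℝ≥0∞, 0 < δ ∧ ∀ Ψ : PeriodicTrialState N L,
      periodicEnergy v Ψ ≤ periodicGroundStateEnergy v N L + δ → ∀ r : Space,
        0 < (∫ X in cellN N L, conj (Ψ.ψ (Function.update X i (X i + r))) * Ψ.ψ X).re := by
  by_contra hcon
  push Not at hcon
  choose Ψ hΨE r hr using fun k : ℕ =>
    hcon (ENNReal.ofReal (1 / ((k : ℝ) + 1))) (ENNReal.ofReal_pos.2 Nat.one_div_pos_of_nat)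
  obtain ⟨f, hf, hf1, φ, hφ, hconv⟩ := CoherencePosHC.exists_groundState_limit hv hL hE Ψ hΨE
  -- a convergent subsequence of the shifts on the compact torus
  obtain ⟨u₀, -, θ, hθ, hu⟩ := isCompact_univ.tendsto_subseq (x := fun n => toUnitTorus L (r (φ n)))
    fun _ => Set.mem_univ _
  -- the amplitudes along the subsequence converge to a positive number
  have hlim := tendsto_re_inner_translate (hconv.comp hθ.tendsto_atTop)
    (((continuous_singleShift i).tendsto u₀).comp hu)
  have hpos₀ := hpos f hf hf1 u₀
  -- but each of them is the cell coherence of a violating near-minimiser, hence `≤ 0`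
  have hle : ∀ n, (⟪(τ[fun p : Fin N × Fin 3 =>
      (Pi.single i (toUnitTorus L (r (φ (θ n)))) : Fin N → UnitAddTorus (Fin 3)) p.1 p.2]
        (ι₀[hL, Ψ (φ (θ n))]) : L2T N), ι₀[hL, Ψ (φ (θ n))]⟫_ℂ).re ≤ 0 := by
    intro n
    have hdict := CoherencePosL2.inner_translate_formEmbed_trialState hL measurable_zeroProfile
      (lintegral_periodicInteraction_zero_ne_top N L) (Ψ (φ (θ n))) (Pi.single i (r (φ (θ n))) : Config N)
    rw [CoherencePosHC.toUnitTorusN_single L i] at hdict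
    rw [hdict]
    have h := hr (φ (θ n))
    simp_rw [update_eq_add_single] at h
    exact h
  exact (not_le.2 hpos₀) (le_of_tendsto' hlim hle)

/-- **All particles** (`Fin N` is finite; the minimum of the slacks). [cite: ReedSimonIV1978, Thm XIII.64] -/
theorem nearMin_pos_of_groundStates (hv : IsRepulsiveFiniteRange v) (hL : 0 < L)
    (hE : periodicGroundStateEnergy v N L ≠ ⊤)
    (hpos : ∀ f : L2T N, f ∈ maxFormGroundStates v N L → ‖f‖ = 1 → ∀ (i : Fin N) (u : UnitAddTorus (Fin 3)),
      0 < (⟪(τ[fun p : Fin N × Fin 3 => (Pi.single i u : Fin N → UnitAddTorus (Fin 3)) p.1 p.2] f : L2T N), f⟫_ℂ).re) :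
    ∃ δ : ℝ≥0∞, 0 < δ ∧ ∀ Ψ : PeriodicTrialState N L,
      periodicEnergy v Ψ ≤ periodicGroundStateEnergy v N L + δ → ∀ (i : Fin N) (r : Space),
        0 < (∫ X in cellN N L, conj (Ψ.ψ (Function.update X i (X i + r))) * Ψ.ψ X).re := by
  choose δ hδ hP using fun i : Fin N => nearMin_pos_particle hv hL hE i fun f hf hf1 u => hpos f hf hf1 i u
  rcases isEmpty_or_nonempty (Fin N) with hN | hN
  · exact ⟨1, one_pos, fun Ψ _ i => (IsEmpty.false i).elim⟩
  refine ⟨Finset.univ.inf' Finset.univ_nonempty δ, ?_, fun Ψ hΨ i r => hP i Ψ ?_ r⟩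
  · exact (Finset.lt_inf'_iff _).2 fun i _ => hδ i
  · exact hΨ.trans (add_le_add le_rfl (Finset.inf'_le _ (Finset.mem_univ i)))

end CoherencePosOfGroundStates

open CoherencePosOfGroundStates in
/-- **`stub_coherencePos_of_groundStates`** (line `registered`, crux stmt-AtomisticToContinuum-9114, lead c4): the
positivity conjunct (P) of the crux in its near-minimiser form FOLLOWS from ground-state coherence positivity — for every
repulsive finite-range `v`, if dilute and eventually in `N` every unit maximal-form ground state has positive translation
amplitude at every single-particle torus shift, then dilute and eventually in `N` some `δ > 0` makes every
`δ`-near-minimiser have strictly positive cell coherence at every particle and every `r ∈ ℝ³` (Ruelle finiteness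
`exists_eventually_periodicGroundStateEnergy_lt_top` for `E₀ < ⊤`, then `nearMin_pos_of_groundStates`).
[cite: ReedSimonIV1978, Thm XIII.64] -/
theorem stub_coherencePos_of_groundStates :
    (∀ v : ℝ → ℝ≥0∞, IsRepulsiveFiniteRange v →
      ∃ ρ₀ : ℝ, 0 < ρ₀ ∧ ∀ ρ : ℝ, 0 < ρ → ρ < ρ₀ → ∀ᶠ N : ℕ in atTop,
        ∀ f : Lp ℂ 2 (volume : Measure (UnitAddTorus (Fin N × Fin 3))),
          f ∈ maxFormGroundStates v N (sideLength ρ N) → ‖f‖ = 1 →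
            ∀ (i : Fin N) (u : UnitAddTorus (Fin 3)),
              0 < (⟪(Lp.compMeasurePreservingₗᵢ ℂ
                  (fun t : UnitAddTorus (Fin N × Fin 3) => t + fun p : Fin N × Fin 3 =>
                    (Pi.single i u : Fin N → UnitAddTorus (Fin 3)) p.1 p.2)
                  (measurePreserving_add_right volume _) f), f⟫_ℂ).re) →
    ∀ v : ℝ → ℝ≥0∞, IsRepulsiveFiniteRange v →
      ∃ ρ₀ : ℝ, 0 < ρ₀ ∧ ∀ ρ : ℝ, 0 < ρ → ρ < ρ₀ → ∀ᶠ N : ℕ in atTop, ∃ δ : ℝ≥0∞, 0 < δ ∧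
        ∀ Ψ : PeriodicTrialState N (sideLength ρ N),
          periodicEnergy v Ψ ≤ periodicGroundStateEnergy v N (sideLength ρ N) + δ → ∀ i : Fin N,
            ∀ r, 0 < (∫ X in cellN N (sideLength ρ N),
              conj (Ψ.ψ (Function.update X i (X i + r))) * Ψ.ψ X).re := by
  intro hPos v hv
  obtain ⟨ρP, hρP, hP⟩ := hPos v hv
  obtain ⟨ρF, hρF, hfin⟩ :=
    Literature.Barriers.AtomisticToContinuum.BoseGas.exists_eventually_periodicGroundStateEnergy_lt_top hv
  refine ⟨min ρP ρF, lt_min hρP hρF, fun ρ hρ hρlt => ?_⟩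
  filter_upwards [hP ρ hρ (hρlt.trans_le (min_le_left _ _)), hfin ρ hρ (hρlt.trans_le (min_le_right _ _)),
    (tendsto_sideLength_atTop hρ).eventually_gt_atTop 0] with N hPN hE hL
  exact nearMin_pos_of_groundStates hv hL hE.ne fun f hf hf1 i u => hPN f hf hf1 i u

end Summit.AtomisticToContinuum.BoseEinsteinCondensation.Theorems

end
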